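import Mathlib

/-!
# Toy ramp + descent inequalities (Lemmas A and C) — T1″ think-pass II §6–§7 (owner ym-idea-3 g18; crux ⟨stmt-QuantumFields-23125⟩ `RationalToGeneral`)

HONEST LABEL.  This file is a TOY-LEVEL rung of the think-pass on the wall stub `stub_analyticFiniteType` (T1″) of the
registered skeleton `Lines/sextic_channel.lean` (v5, commit 9dfcf5fb94f6, UNCHANGED).  It is *not* a stub of that skeleton,
closes nothing on the ledger, and says nothing about ⟨23125⟩, ⟨23035⟩, rung R2d or the Yang–Mills summit.

CONTENT.  In the geometric toy of memo `T1pp_tower_economy_II.md` (§2) the budget hypothesis `sup_{|x|=r} |K(x)| = o(r⁻⁸)`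
forces, for every harmonic channel of degree `L ≥ 8` with scale-free shell coefficients `v 0, v 1, …` on the mass shells
`λ^0, λ^1, …`, the twisted moment identities `∑ j, v j * (λ^{-2m})^j = 0` for `m = 0, …, (L-6)/2` (memo §2, (M_L)).
The smallest node `x₀ = λ^{-(L-6)} ∈ (0,1)` alone already yields the RAMP (memo §6 (6c), R4 of memo I made universal and
quantitative): if the channel's lowest atom is positive and the channel stays non-negative on its first `k ≥ 1` shells,
then somewhere at or above shell `k` it carries a NEGATIVE atom of size `> (1 - x₀) · x₀^{-k} · v 0`, i.e. at least
`≈ λ^{(L-6)k}` times its bottom atom.  Negative atoms of the top degree on a shell violate shell positivity and must be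
covered by fresh higher degrees, whose own ramps are steeper — the «fresh-channel explosion» of memo §6 (6d).

The theorem below is the exact finite-support form (any window `0..n`; the infinite-support form follows by truncation
since admissible sequences are bounded and the node is `< 1`).  Elementary; kernel-checked so that the one inequality the
mechanism leans on is not a float.

LEMMA C (added 05:20Z, dossier `Lines/sextic_channel_T1pp.md` §1/§4).  The DESCENT half of the floor dichotomy: if a
channel's atom at shell `t` is positive and bounds everything above it from below (`v j ≥ -v t` for `j > t`, e.g. `v t`
is the channel's largest atom), then at every node `x < 1/2` (`λ^{2m} > 2`) the weighted sum of the atoms strictly BELOW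
`t` is `≤ -v t · x^t · (1-2x)/(1-x) < 0` (`weightedSum_below_top_le`, division-free), so a negative atom sits strictly
below the maximum (`exists_neg_below_top`, `exists_neg_below_top_of_twistedMoment`).  Together: positive bottoms ramp UP
(Lemma A), positive tops force negatives DOWN (Lemma C); what is not decided here is the floor dichotomy itself (§4).
-/

namespace Summit.QuantumFields.YangMills.Cruxes.RationalToGeneral.SexticChannel.ToyRamp

open Finset

/-- **Ramp inequality (geometric node).**  Let `0 < x₀`, `1 ≤ k`, and let `v 0, …, v n` satisfy the weighted
zero-sum `∑_{j ≤ n} v j · x₀^j = 0` with `v 0 > 0` and `v j ≥ 0` for `j < k`.  Then some index `j ∈ [k, n]` has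
`v j < -(1 - x₀) / x₀^k · v 0` (meaningful for a node `x₀ < 1`, where the bound is `≈ -x₀^{-k} · v 0`). -/
theorem exists_lt_neg_of_geomMoment_eq_zero {x₀ : ℝ} (hx₀ : 0 < x₀) {n k : ℕ} (hk : 1 ≤ k)
    (v : ℕ → ℝ) (hmom : ∑ j ∈ range (n + 1), v j * x₀ ^ j = 0) (hpos : 0 < v 0)
    (hnonneg : ∀ j, j < k → 0 ≤ v j) :
    ∃ j, k ≤ j ∧ j ≤ n ∧ v j < -((1 - x₀) / x₀ ^ k * v 0) := by
  by_contra hcon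
  push Not at hcon
  set c : ℝ := (1 - x₀) / x₀ ^ k * v 0 with hc
  have hxk : 0 < x₀ ^ k := pow_pos hx₀ k
  rcases Nat.lt_or_ge n k with hnk | hnk
  · -- every index of the window lies below `k`: all terms are ≥ 0 and the `j = 0` term is > 0
    have hsum : 0 < ∑ j ∈ range (n + 1), v j * x₀ ^ j := by
      rw [Finset.sum_range_succ']
      simp only [pow_zero, mul_one]
      have h1 : 0 ≤ ∑ j ∈ range n, v (j + 1) * x₀ ^ (j + 1) :=
        Finset.sum_nonneg fun j hj =>
          mul_nonneg (hnonneg _ (by have := Finset.mem_range.mp hj; omega)) (pow_nonneg hx₀.le _)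
      linarith
    linarith
  · obtain ⟨m, hm⟩ : ∃ m, n + 1 = k + m := ⟨n + 1 - k, by omega⟩
    rw [hm, Finset.sum_range_add] at hmom
    -- the first `k` shells contribute at least `v 0`
    have hfirst : v 0 ≤ ∑ j ∈ range k, v j * x₀ ^ j := by
      obtain ⟨k', rfl⟩ : ∃ k', k = k' + 1 := ⟨k - 1, by omega⟩
      rw [Finset.sum_range_succ']
      simp only [pow_zero, mul_one]
      have h1 : 0 ≤ ∑ j ∈ range k', v (j + 1) * x₀ ^ (j + 1) :=
        Finset.sum_nonneg fun j hj =>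
          mul_nonneg (hnonneg _ (by have := Finset.mem_range.mp hj; omega)) (pow_nonneg hx₀.le _)
      linarith
    -- the remaining shells contribute at least `-c · x₀^k · ∑_{i<m} x₀^i`
    have hsecond : -(c * x₀ ^ k) * ∑ i ∈ range m, x₀ ^ i ≤ ∑ i ∈ range m, v (k + i) * x₀ ^ (k + i) := by
      rw [Finset.mul_sum]
      apply Finset.sum_le_sum
      intro i hi
      have hi' := Finset.mem_range.mp hi
      have hv : -c ≤ v (k + i) := hcon (k + i) (by omega) (by omega)
      have hxi : 0 ≤ x₀ ^ (k + i) := pow_nonneg hx₀.le _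
      calc -(c * x₀ ^ k) * x₀ ^ i = (-c) * x₀ ^ (k + i) := by rw [pow_add]; ring
        _ ≤ v (k + i) * x₀ ^ (k + i) := mul_le_mul_of_nonneg_right hv hxi
    have hgeom : (∑ i ∈ range m, x₀ ^ i) * (1 - x₀) = 1 - x₀ ^ m := geom_sum_mul_neg x₀ m
    have hcS : c * x₀ ^ k * ∑ i ∈ range m, x₀ ^ i = v 0 * (1 - x₀ ^ m) := by
      rw [← hgeom, hc]
      field_simp
    have hsecond' : -(v 0 * (1 - x₀ ^ m)) ≤ ∑ i ∈ range m, v (k + i) * x₀ ^ (k + i) := by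
      have h := hsecond
      rw [show -(c * x₀ ^ k) * ∑ i ∈ range m, x₀ ^ i = -(c * x₀ ^ k * ∑ i ∈ range m, x₀ ^ i) by ring,
        hcS] at h
      exact h
    have hxm : 0 < v 0 * x₀ ^ m := mul_pos hpos (pow_pos hx₀ m)
    nlinarith [hfirst, hsecond', hxm, hmom]

/-- **Ramp inequality, shell form.**  For a mass ratio `λ > 1` and a channel with `M + 1` twisted moment identities
(`M = (L-6)/2 ≥ 1` for degree `L ≥ 8`), the top identity (node `(λ^2)^{-M} = λ^{-(L-6)}`) forces: a channel that is
positive at its lowest shell and non-negative on its first `k ≥ 1` shells carries, at some shell `j ∈ [k, n]`, a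
negative atom exceeding `(1 - λ^{-2M}) · λ^{2Mk}` times its bottom atom. -/
theorem ramp_of_topTwistedMoment_eq_zero {lam : ℝ} (hlam : 1 < lam) (M : ℕ) {n k : ℕ} (hk : 1 ≤ k)
    (v : ℕ → ℝ) (hmom : ∑ j ∈ range (n + 1), v j * ((lam ^ (2 * M))⁻¹) ^ j = 0) (hpos : 0 < v 0)
    (hnonneg : ∀ j, j < k → 0 ≤ v j) :
    ∃ j, k ≤ j ∧ j ≤ n ∧ v j < -((1 - (lam ^ (2 * M))⁻¹) * (lam ^ (2 * M)) ^ k * v 0) := by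
  have hx₀ : 0 < (lam ^ (2 * M))⁻¹ := inv_pos.mpr (pow_pos (by linarith) _)
  obtain ⟨j, hkj, hjn, hv⟩ := exists_lt_neg_of_geomMoment_eq_zero hx₀ hk v hmom hpos hnonneg
  refine ⟨j, hkj, hjn, ?_⟩
  have : (1 - (lam ^ (2 * M))⁻¹) / ((lam ^ (2 * M))⁻¹) ^ k * v 0
      = (1 - (lam ^ (2 * M))⁻¹) * (lam ^ (2 * M)) ^ k * v 0 := by
    rw [inv_pow, div_inv_eq_mul]
  rw [this] at hv
  exact hv

/-- **Lemma C, quantitative form.**  `0 ≤ x ≤ 1`, window `0..n`, `t ≤ n`, weighted zero-sum, `v t ≥ 0`, and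
`v j ≥ -v t` above `t`.  Then `(1 - x) · ∑_{j<t} v j x^j ≤ -v t · x^t · (1 - 2x)`. -/
theorem weightedSum_below_top_le {x : ℝ} (hx0 : 0 ≤ x) (hx1 : x ≤ 1) {n t : ℕ} (ht : t ≤ n)
    (v : ℕ → ℝ) (hmom : ∑ j ∈ range (n + 1), v j * x ^ j = 0) (htop : 0 ≤ v t)
    (hbound : ∀ j, t < j → j ≤ n → -v t ≤ v j) :
    (1 - x) * ∑ j ∈ range t, v j * x ^ j ≤ -(v t * x ^ t * (1 - 2 * x)) := by
  obtain ⟨m, hm⟩ : ∃ m, n + 1 = (t + 1) + m := ⟨n - t, by omega⟩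
  rw [hm, Finset.sum_range_add, Finset.sum_range_succ] at hmom
  set A : ℝ := ∑ j ∈ range t, v j * x ^ j with hA
  set T : ℝ := ∑ i ∈ range m, v (t + 1 + i) * x ^ (t + 1 + i) with hT
  set G : ℝ := ∑ i ∈ range m, x ^ i with hG
  set p : ℝ := v t * x ^ t with hp
  have hxt : 0 ≤ x ^ t := pow_nonneg hx0 t
  have hxm : 0 ≤ x ^ m := pow_nonneg hx0 m
  have hp0 : 0 ≤ p := mul_nonneg htop hxt
  have h1x : 0 ≤ 1 - x := by linarith
  -- the tail is bounded below by `-(p x) · G`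
  have htail : -(p * x) * G ≤ T := by
    rw [hG, Finset.mul_sum, hT]
    apply Finset.sum_le_sum
    intro i hi
    have hi' := Finset.mem_range.mp hi
    have hb : -v t ≤ v (t + 1 + i) := hbound (t + 1 + i) (by omega) (by omega)
    have hxpow : 0 ≤ x ^ (t + 1 + i) := pow_nonneg hx0 _
    calc -(p * x) * x ^ i = (-v t) * x ^ (t + 1 + i) := by rw [hp, pow_add, pow_succ]; ring
      _ ≤ v (t + 1 + i) * x ^ (t + 1 + i) := mul_le_mul_of_nonneg_right hb hxpow
  have hgeom : G * (1 - x) = 1 - x ^ m := geom_sum_mul_neg x m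
  -- hence `(1 - x) T ≥ -(p x)(1 - x^m) ≥ -(p x)`
  have hT1 : -(p * x) * (1 - x ^ m) ≤ (1 - x) * T := by
    have h := mul_le_mul_of_nonneg_left htail h1x
    calc -(p * x) * (1 - x ^ m) = (1 - x) * (-(p * x) * G) := by rw [← hgeom]; ring
      _ ≤ (1 - x) * T := h
  have hpxm : 0 ≤ p * x * x ^ m := by positivity
  have hAeq : A = -p - T := by rw [hp]; linarith
  rw [hAeq]
  nlinarith [hT1, hpxm, hp0, h1x]

/-- **Lemma C, existence form.**  At a node `0 < x < 1/2`, a channel whose atom at shell `t` is POSITIVE and bounds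
everything above it from below (`v j ≥ -v t` for `t < j ≤ n`) has a NEGATIVE atom strictly below shell `t`. -/
theorem exists_neg_below_top {x : ℝ} (hx0 : 0 < x) (hx : x < 1 / 2) {n t : ℕ} (ht : t ≤ n)
    (v : ℕ → ℝ) (hmom : ∑ j ∈ range (n + 1), v j * x ^ j = 0) (htop : 0 < v t)
    (hbound : ∀ j, t < j → j ≤ n → -v t ≤ v j) :
    ∃ j, j < t ∧ v j < 0 := by
  have hle := weightedSum_below_top_le hx0.le (by linarith) ht v hmom htop.le hbound
  by_contra hcon
  push Not at hcon
  have hA : 0 ≤ ∑ j ∈ range t, v j * x ^ j :=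
    Finset.sum_nonneg fun j hj => mul_nonneg (hcon j (Finset.mem_range.mp hj)) (pow_nonneg hx0.le _)
  have hxt : 0 < x ^ t := pow_pos hx0 t
  have h1 : 0 < v t * x ^ t * (1 - 2 * x) := by
    have : 0 < 1 - 2 * x := by linarith
    positivity
  have h2 : 0 ≤ (1 - x) * ∑ j ∈ range t, v j * x ^ j := mul_nonneg (by linarith) hA
  linarith

/-- **Lemma C at a twisted-moment node.**  With `x = (λ^{2M})⁻¹` and `λ^{2M} > 2`: the channel's positive maximum at
shell `t` forces a negative atom strictly below `t` — descent.  (For `λ² > 2` every node `M ≥ 1` qualifies; for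
`1 < λ² ≤ 2` the nodes with `λ^{2M} > 2` do, and a channel of degree `L` has nodes up to `M = (L-6)/2`.) -/
theorem exists_neg_below_top_of_twistedMoment {lam : ℝ} (M : ℕ) (hnode : 2 < lam ^ (2 * M)) {n t : ℕ}
    (ht : t ≤ n) (v : ℕ → ℝ) (hmom : ∑ j ∈ range (n + 1), v j * ((lam ^ (2 * M))⁻¹) ^ j = 0)
    (htop : 0 < v t) (hbound : ∀ j, t < j → j ≤ n → -v t ≤ v j) :
    ∃ j, j < t ∧ v j < 0 := by
  have hy : 0 < lam ^ (2 * M) := by linarith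
  have hx0 : 0 < (lam ^ (2 * M))⁻¹ := inv_pos.mpr hy
  have hx : (lam ^ (2 * M))⁻¹ < 1 / 2 := by
    rw [inv_lt_comm₀ hy (by norm_num : (0:ℝ) < 1 / 2)]
    norm_num; linarith
  exact exists_neg_below_top hx0 hx ht v hmom htop hbound

end Summit.QuantumFields.YangMills.Cruxes.RationalToGeneral.SexticChannel.ToyRamp
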